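import Summits.BirchSwinnertonDyer.Rank1Residual.ManinAdditive.NeronConwayLevel
import Summits.BirchSwinnertonDyer.Rank1Residual.ManinAdditive.NeronCuspThree
import HarnessLib
import HarnessLib.Audit.Tags

/-!
# THE KATZ–MAZUR/EDIXHOVEN INTERSECTION LP — three further vertices, certified for every level on paper: E-imc-146
# `TwoAdicAtkinLehnerDenominator`, E-imc-147 `DiagonalCuspLaw`, E-imc-149♭ `OddPrimeAtkinLehnerDenominator` (HOME/imc/PROOFS-g19.md
# 4291bb151a99bf48 §3 Theorem 2 (E-146), (E-147); §5 Theorem 4 SINGLE (E-149♭)) — cell `bsd-f2-manin` (D-0131 (3) frontier), lens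
# imc, planner imc g19 (planner-of-record) MEMO-imc §25; typed by the cell typer g14 (T-imc-25, 2026-08-28T19:15:26Z) VERBATIM from
# HOME/imc/Sketch-imc-g19.lean sha16 db3209a132b836f3 (farm rc 0 · 0 warnings · 0 sorries), docstrings extended with the framing.
# TYPER FRAMING: E-BLIND LAWS, nothing asserted; PAPER STATUS (imc): theorems for every level modulo the dictionary (D1)–(D5)
# (refuter-1 §R78: (D1)–(D5) PASS with provisos P1–P3; closed-form certificates verified exactly, HOME/imc/kit-g19/allv_certify.py
# e8b4a047a8973e99: 20 laws, 258 identities, 0 failures); REF1 R-imc-58 (audit of PROOFS-g19 §1, Lemmas 1–2, one law by hand) and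
# REF2 P-ref2-g19 (placement: DR VII / Katz give `ℤ[ζ_N, 1/N]`; ČNS Thm 1.5 newforms only; Edixhoven 1990 §1 the model) PENDING at
# filing — a finding is repaired under a NEW name (append-only).  NOT in print as lattice statements.  bears_on:
# stmt-BirchSwinnertonDyer-22967 / 22968 (E-blind lower-bound side only).  PARTITION ladder-live · beyond-print theorem: candidate
# (imc, paper) / no in Lean · BSD is not proved by this; Manin `c = 1` is not proved by this.

imc g19 text:

HONEST FRAMING.  E-blind statements about `S = S₂(Γ₀(N); ℤ)`.  PROOFS-g19 proves them for all levels MODULO the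
dictionary (D1)–(D5) between q-expansion integrality at a cusp and the order of the attached section of the dualising sheaf
along the Katz–Mazur component carrying that cusp (audited PASS by the cell's refuter-1 §R78, provisos P1–P3).  Nothing is
asserted as a theorem here: the three laws are `@[conjecture]` defs.  They bear on the cruxes C2 `ManinOddAtFour`
(stmt-22967) and C3 `ManinPrimeToThreeAtNine` (stmt-22968) on the E-blind, LOWER-bound side only: no upper bound on
`ord_p c_E` follows; Manin `c = 1` is not proved; BSD is not proved by this.
BC5 witnesses: E-146 — ENGINE 6 v20 (kit j314702, 96 levels `4 ∣ N ≤ 400`): field `e0 ≤ v+1`, 0 violations, ATTAINED at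
v = 2, 3, 4 (MEMO-imc (24.24)(e)); E-147 — same table, diagonal pair fields (`D4W`, `D8W`), 0 violations, attained v = 3, 4;
E-149♭ — at p = 3 it is the landed `NeronCuspThree.ThreeAdicAtkinLehnerDenominator` (76/76 levels `9 ∣ N ≤ 702`); for
p ≥ 5 the exact ILP of kit-g18/model/kmlpP.py (values v for v = 2, 3, 4 at p = 5, 7) — no q-expansion table yet (ask D-imc-25).
New vocabulary: `IsPrimeToIntegral p` (= `NeronCuspThree.IsThreeIntegral` with 3 ↦ p).
-/

noncomputable section

open scoped MatrixGroups ModularForm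
open CongruenceSubgroup Literature.NumberTheory.EllipticCurves.ModularForms
  Summit.BirchSwinnertonDyer.Rank1Residual.ManinAdditive
  Summit.BirchSwinnertonDyer.Rank1Residual.ManinAdditive.ConwayCut
  Summit.BirchSwinnertonDyer.Rank1Residual.ManinAdditive.NeronConwayLevel
  Summit.BirchSwinnertonDyer.Rank1Residual.ManinAdditive.NeronCuspThree

namespace Summit.BirchSwinnertonDyer.Rank1Residual.ManinAdditive.KMIntersectionLP

variable (N : ℕ) [NeZero N]

/-- `x` is `p`-adically integral at `∞`: some prime-to-`p` multiple of `x` lies in `S₂(Γ₀(N); ℤ)`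
(`IsThreeIntegral` with `3 ↦ p`). -/
def IsPrimeToIntegral (p : ℕ) (x : CuspForm (Gamma0 N) 2) : Prop :=
  ∃ m : ℕ, ¬ p ∣ m ∧ (m : ℂ) • x ∈ integralCuspForms0 N 2

omit [NeZero N] in
/-- Consistency edge: at `p = 3` the new predicate is the tree's `IsThreeIntegral`. -/
theorem isPrimeToIntegral_three_iff (x : CuspForm (Gamma0 N) 2) :
    IsPrimeToIntegral N 3 x ↔ IsThreeIntegral N x := Iff.rfl

/-- LAW E-imc-146 `TwoAdicAtkinLehnerDenominator` (imc g19; = the single-cusp vertex `{∞} → 0` of the KM LP at 2,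
value `v+1`, PROOFS-g19 §3 Theorem 2 (E-146) for every `v₂(N) ≥ 2`, modulo the dictionary): for `4 ∣ N` and every
integral cusp form `x`, `2^{v₂(N)+1} · w_{2^{v₂(N)}} x` is integral.  Sharp at v = 2, 3, 4 (ENGINE 6 v20).
Why it might fail: only through the dictionary (D1) (q-expansion ⟷ order along the reduced component `C_0`).
TYPER FRAMING: BC5 ENGINE 6 v20 (kit j314702, 96 levels `4 ∣ N ≤ 400`): `e0 ≤ v+1` 0 violations, attained at v = 2, 3, 4; REF1
R-imc-58 PENDING.  OPEN in Lean.
[cite: Edixhoven1991, §1 (shape only: the model of `X₀(N)` at `2`; the `2^{v+1}` Atkin–Lehner denominator law is the cell's E-imc-146 — imc PROOFS-g19 §3)] -/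
@[conjecture] def TwoAdicAtkinLehnerDenominator : Prop :=
  ∀ (N : ℕ) [NeZero N], 4 ∣ N → ∀ x ∈ integralCuspForms0 N 2,
    ((2 : ℂ) ^ (padicValNat 2 N + 1)) • atkinLehnerInvolutionAt N 2 2 x ∈ integralCuspForms0 N 2

/-- LAW E-imc-147 `DiagonalCuspLaw` (imc g19; = the diagonal vertex `{∞, 1/(N/2)} → 0` of the KM LP at 2, value
`v−1`, PROOFS-g19 §3 Theorem 2 (E-147) for every `v₂(N) ≥ 3`): for `8 ∣ N`, an integral cusp form `x` that is also
integral at the cusp `1/(N/2)` (`w(t(w x))` integral) has `2^{v₂(N)−1} · w x` integral.  Sharp at v = 3, 4.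
Why it might fail: only through the dictionary (D1)/(D3).
TYPER FRAMING: BC5 ENGINE 6 v20 diagonal-pair fields `D4W`/`D8W`, 0 violations, attained v = 3, 4; REF1 R-imc-58 PENDING.  OPEN.
[cite: Edixhoven1991, §1 (shape only; the diagonal cusp law is the cell's E-imc-147 — imc PROOFS-g19 §3)] -/
@[conjecture] def DiagonalCuspLaw : Prop :=
  ∀ (N : ℕ) [NeZero N], 8 ∣ N → ∀ x ∈ integralCuspForms0 N 2,
    atkinLehnerInvolutionAt N 2 2 (halfTranslate N 2 (atkinLehnerInvolutionAt N 2 2 x)) ∈ integralCuspForms0 N 2 →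
    ((2 : ℂ) ^ (padicValNat 2 N - 1)) • atkinLehnerInvolutionAt N 2 2 x ∈ integralCuspForms0 N 2

/-- LAW E-imc-149♭ `OddPrimeAtkinLehnerDenominator` (imc g19; = the single-cusp vertex of the KM LP at an ODD prime
`p`, value `v`, PROOFS-g19 §5 Theorem 4 SINGLE — uniform in `p` and `v`, modulo the dictionary): for `p` an odd prime
dividing `N` and every integral cusp form `x`, `p^{v_p(N)} · w_{p^{v_p(N)}} x` is `p`-adically integral.  At
`p = 3` this is `NeronCuspThree.ThreeAdicAtkinLehnerDenominator` (edge below).  No q-expansion table for `p ≥ 5` yet.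
Why it might fail: the dictionary at `p ≥ 5` has only been exercised at `p = 2, 3` (kit engines); a `ℤ[ζ_p]`-engine
at `p = 5` is the cheapest falsifier (ask D-imc-25).
TYPER FRAMING: BC5 at `p = 3` = the landed E-imc-145 census (76/76 levels `9 ∣ N ≤ 702`, g18-kmlp3test-p3-v2 ed7811b0a08952ec);
at `p ≥ 5` only the exact ILP values (no q-expansion table; D-imc-25 optional ask); REF1 R-imc-58 / REF2 P-ref2-g19 PENDING.  OPEN.
[cite: Edixhoven1991, §1 (shape only; the uniform odd-prime Atkin–Lehner denominator law is the cell's E-imc-149♭ — imc PROOFS-g19 §5 Theorem 4)] -/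
@[conjecture] def OddPrimeAtkinLehnerDenominator : Prop :=
  ∀ (p : ℕ), p.Prime → p ≠ 2 → ∀ (N : ℕ) [NeZero N], p ∣ N → ∀ x ∈ integralCuspForms0 N 2,
    IsPrimeToIntegral N p (((p : ℂ) ^ (padicValNat p N)) • atkinLehnerInvolutionAt N 2 p x)

/-- Edge E-149♭ ⟹ E-145 (PROVED): specialise the uniform law to `p = 3`. -/
theorem threeAdicAtkinLehnerDenominator_of_oddPrime (h : OddPrimeAtkinLehnerDenominator) :
    ThreeAdicAtkinLehnerDenominator := by
  intro N _ h3 x hx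
  have := h 3 Nat.prime_three (by decide) N h3 x hx
  simpa [IsPrimeToIntegral, IsThreeIntegral] using this

end Summit.BirchSwinnertonDyer.Rank1Residual.ManinAdditive.KMIntersectionLP

end
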